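import Summits.AtomisticToContinuum.BoseEinsteinCondensation.Theses.BECGroundStateSOS
import Literature.Barriers.AtomisticToContinuum.KineticGapLengthScalesThermodynamicWindow

/-!
# Route `BECGroundStateSOS`, support item `PeriodicEnergyFinite` (stmt-AtomisticToContinuum-3974)

FINITENESS of the periodic ground-state energy along the thermodynamic box sequence: for every
repulsive finite-range pair potential `v` (hard cores allowed) there is `ρ₀ > 0` such that for
`0 < ρ < ρ₀` and all large `N` the periodic `N`-body ground-state energy on the torus of side
`L_N = (N/ρ)^{1/3}` is finite, `E₀^per(N, L_N) ≠ ⊤`.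

This is exactly the tree's
`Literature.Barriers.AtomisticToContinuum.BoseGas.exists_eventually_periodicGroundStateEnergy_lt_top`
(Ruelle finiteness below close packing, Ruelle 1969 §3.5.11, via "periodic ≤ Dirichlet at the
double density" and `limsup_lt_top_of_small`), restated with `≠ ⊤` in place of `< ⊤`.

References: D. Ruelle, *Statistical Mechanics: Rigorous Results* (1969), §3.5.11; LSSY 2005,
Thm. 2.2 (the alternative route via the Dyson upper bound, not used here).
-/

noncomputable section

namespace Summit.AtomisticToContinuum.BoseEinsteinCondensation.Theorems

open Filter
open scoped ENNReal

/-- **`PeriodicEnergyFinite` holds** (settles stmt-AtomisticToContinuum-3974, exact route decl):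
for every repulsive finite-range `v` there is `ρ₀ > 0` with
`∀ ρ ∈ (0, ρ₀), ∀ᶠ N, periodicGroundStateEnergy v N (sideLength ρ N) ≠ ⊤`. Immediate from
`exists_eventually_periodicGroundStateEnergy_lt_top` (Ruelle 1969 §3.5.11 finiteness of the
energy per particle below close packing, as proved in the tree). [folklore] -/
theorem periodicEnergyFinite_proof :
    Summit.AtomisticToContinuum.BoseEinsteinCondensation.Theses.BECGroundStateSOS.PeriodicEnergyFinite := by
  unfold Summit.AtomisticToContinuum.BoseEinsteinCondensation.Theses.BECGroundStateSOS.PeriodicEnergyFinite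
  intro v hv
  obtain ⟨ρ₁, hρ₁, h⟩ :=
    Literature.Barriers.AtomisticToContinuum.BoseGas.exists_eventually_periodicGroundStateEnergy_lt_top
      hv
  exact ⟨ρ₁, hρ₁, fun ρ hρ hρρ₁ => (h ρ hρ hρρ₁).mono fun N hN => hN.ne⟩

end Summit.AtomisticToContinuum.BoseEinsteinCondensation.Theorems

end
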